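import Literature.NumberTheory.Weil1965.LocalQuadraticGaussTransformGeneralForm
import Literature.NumberTheory.Weil1965.LocalQuadraticFibreDensity
import Mathlib.LinearAlgebra.Matrix.SesquilinearForm
import HarnessLib

/-!
# Decay of the Gauss transform of `x ↦ xᵀ S x` for an invertible symmetric matrix `S` (finite places)

Topic `NumberTheory/Weil1965`; namespace `Literature.NumberTheory.Weil1965`.  KERNEL mathematics only (theorems; no
definition, no named fact, no `axiom`, no proof hole).  Matrix spelling of `LocalQuadraticGaussTransformGeneralForm.lean`
for the consumers whose quadratic forms come as Gram matrices (`x ⬝ᵥ S *ᵥ x`, `S` symmetric with `det S ≠ 0` — the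
`T_V`, `T_V ⊕ (−d T_V)` of the Siegel–Weil stubs): the bilinear form `(x, y) ↦ x ⬝ᵥ S *ᵥ y` (Mathlib
`Matrix.toLinearMap₂'`) is symmetric and non-degenerate, it is the associated form of the quadratic form
`Matrix.toQuadraticForm' S`, and Weil's decay estimate [Weil1965, Chap. I n° 2 Prop. 2] holds for it:

  `‖∫ Φ(x) ψ(β · xᵀ S x) dμ^⊗ι‖ ≤ C · max(1, ‖β‖)^{-r/2}`   (`exists_norm_integral_mul_addChar_dotProduct_mulVec_le_max_rpow`);

and, by the same change of variables, Weil's Proposition 6 [Weil1965, Chap. III n° 36] for a GENERAL non-degenerate form in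
`r ≥ 3` variables: the image of `Φ dμ^⊗ι` under `Q` has a CONTINUOUS BOUNDED density
(`exists_continuous_fibreDensity_quadraticForm`, `exists_continuous_fibreDensity_dotProduct_mulVec`).

## References

* [Weil1965] A. Weil, *Sur la formule de Siegel dans la théorie des groupes classiques*, Acta Math. 113 (1965) 1–87:
  Chap. I n° 2 Prop. 2 (p. 8).
-/

set_option autoImplicit false

noncomputable section

open MeasureTheory ValuativeRel Filter Topology Set
open scoped NNReal ENNReal Pointwise Matrix
open Literature.NumberTheory.GaloisRepresentations.IsNonarchimedeanLocalField
open Literature.NumberTheory.Automorphic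
open Literature.NumberTheory.Weil1964

namespace Literature.NumberTheory.Weil1965

variable {F : Type*} [Field F]

section MatrixForm

variable {ι : Type*} [Fintype ι] [DecidableEq ι]

/-- the quadratic form of a matrix: `toQuadraticForm' S x = x ⬝ᵥ S *ᵥ x`. [folklore] -/
private theorem toQuadraticForm'_apply (S : Matrix ι ι F) (x : ι → F) :
    Matrix.toQuadraticForm' S x = x ⬝ᵥ S *ᵥ x := by
  rw [Matrix.toQuadraticForm', LinearMap.BilinMap.toQuadraticMap_apply, Matrix.toLinearMap₂'_apply']

/-- for a symmetric `S` the bilinear form `x ⬝ᵥ S *ᵥ y` is symmetric. [folklore] -/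
private theorem toLinearMap₂'_symm {S : Matrix ι ι F} (hS : S.IsSymm) (x y : ι → F) :
    Matrix.toLinearMap₂' F S x y = Matrix.toLinearMap₂' F S y x := by
  rw [Matrix.toLinearMap₂'_apply', Matrix.toLinearMap₂'_apply', Matrix.dotProduct_mulVec, ← Matrix.mulVec_transpose,
    hS.eq, dotProduct_comm]

/-- for a symmetric invertible `S` (char `≠ 2`) the associated bilinear form of `x ↦ xᵀ S x` is `(x,y) ↦ xᵀ S y` and it
is non-degenerate. [cite: Weil1964, Chap. I n° 3, p. 147] -/
theorem separatingLeft_associated_toQuadraticForm' [Invertible (2 : F)] {S : Matrix ι ι F} (hS : S.IsSymm)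
    (hSd : S.det ≠ 0) : (QuadraticMap.associated (R := F) (Matrix.toQuadraticForm' S)).SeparatingLeft := by
  have h : QuadraticMap.associated (R := F) (Matrix.toQuadraticForm' S) = Matrix.toLinearMap₂' F S :=
    QuadraticMap.associated_left_inverse F (toLinearMap₂'_symm hS)
  rw [h]
  exact LinearMap.separatingLeft_toLinearMap₂'_iff_det_ne_zero.2 hSd

variable [ValuativeRel F] [TopologicalSpace F] [IsNonarchimedeanLocalField F]
variable [MeasurableSpace F] [BorelSpace F] (μ : Measure F) [μ.IsAddHaarMeasure] {ψ : AddChar F Circle}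

/-- **WEIL'S DECAY for `x ↦ xᵀ S x`**, `S` symmetric with `det S ≠ 0`, over a `p`-field with `2 ≠ 0`: for every
Schwartz–Bruhat `Φ` there is `C ≥ 0` with `‖∫ Φ(x) ψ(β · x ⬝ᵥ S *ᵥ x) dμ^⊗ι‖ ≤ C · max(1, ‖β‖)^{-r/2}` for all `β`
(`r = card ι`). [cite: Weil1965, Chap. I n° 2 Prop. 2, p. 8] -/
theorem exists_norm_integral_mul_addChar_dotProduct_mulVec_le_max_rpow [Invertible (2 : F)] {d : ℤ}
    (hd : ψ.HasConductorExp d) {v₂ : ℤ} (h2 : normAbs F (2 : F) = (residueFieldCard F : ℝ≥0)⁻¹ ^ v₂)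
    {S : Matrix ι ι F} (hS : S.IsSymm) (hSd : S.det ≠ 0) {Φ : (ι → F) → ℂ} (hΦ : Φ ∈ SchwartzBruhat (ι → F)) :
    ∃ C : ℝ, 0 ≤ C ∧ ∀ β : F,
      ‖∫ x, Φ x * ((ψ (β * (x ⬝ᵥ S *ᵥ x)) : Circle) : ℂ) ∂(Measure.pi fun _ : ι => μ)‖ ≤
        C * ((max 1 (normAbs F β) : ℝ≥0) : ℝ) ^ (-((Fintype.card ι : ℝ) / 2)) := by
  obtain ⟨C, hC0, hC⟩ := exists_norm_integral_mul_addChar_quadraticForm_le_max_rpow μ hd h2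
    (Matrix.toQuadraticForm' S) (separatingLeft_associated_toQuadraticForm' hS hSd) hΦ
  refine ⟨C, hC0, fun β => ?_⟩
  simpa only [toQuadraticForm'_apply] using hC β

omit [DecidableEq ι] in
/-- **change of variables for the push-forward**: if `Q(x) = Σ cᵢ (e x)ᵢ²` then
`∫ Φ(x) g(Q x) dμ^⊗ι = ‖det e‖⁻¹ · ∫ Φ(e⁻¹ y) g(Σ cᵢ yᵢ²) dμ^⊗ι(y)` for any test function `g`.
[cite: Weil1964, Chap. II n° 25, p. 173] -/
theorem integral_mul_comp_eq_of_eq_sum_sq (Φ : (ι → F) → ℂ) (g : F → ℂ) {Q : (ι → F) → F}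
    (e : (ι → F) ≃ₗ[F] (ι → F)) (c : ι → F) (hQ : ∀ x, Q x = ∑ i, c i * (e x) i ^ 2) :
    ∫ x, Φ x * g (Q x) ∂(Measure.pi fun _ : ι => μ) =
      ((normAbs F (LinearMap.det (e : (ι → F) →ₗ[F] (ι → F)))⁻¹ : ℝ≥0) : ℝ) •
        ∫ y, Φ (e.symm y) * g (∑ i, c i * y i ^ 2) ∂(Measure.pi fun _ : ι => μ) := by
  rw [← integral_comp_linearEquiv μ e]
  refine integral_congr_ae (Eventually.of_forall fun x => ?_)
  simp only [LinearEquiv.symm_apply_apply, hQ x]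

omit [DecidableEq ι] in
/-- **WEIL'S PROPOSITION 6 FOR A GENERAL NON-DEGENERATE QUADRATIC FORM** (finite place, `r ≥ 3`, char `≠ 2`): the image of
`Φ dμ^⊗ι` under `Q` has a continuous bounded density `D` on ALL of `F` — `∫ D(b) g(b) dμ = ∫ Φ(x) g(Q x) dμ^⊗ι` for every
Schwartz–Bruhat `g` (diagonalise, change variables, ★ `exists_continuous_fibreDensity`).
[cite: Weil1965, Chap. III n° 36 Prop. 6, p. 54] -/
theorem exists_continuous_fibreDensity_quadraticForm [Invertible (2 : F)] {d : ℤ} (hd : ψ.HasConductorExp d)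
    {v₂ : ℤ} (h2 : normAbs F (2 : F) = (residueFieldCard F : ℝ≥0)⁻¹ ^ v₂) (Q : QuadraticForm F (ι → F))
    (hQ : (QuadraticMap.associated (R := F) Q).SeparatingLeft) {Φ : (ι → F) → ℂ}
    (hΦ : Φ ∈ SchwartzBruhat (ι → F)) (hr : 3 ≤ Fintype.card ι) :
    ∃ D : F → ℂ, Continuous D ∧ (∃ M : ℝ, ∀ b, ‖D b‖ ≤ M) ∧
      ∀ g ∈ SchwartzBruhat F, ∫ b, D b * g b ∂μ = ∫ x, Φ x * g (Q x) ∂(Measure.pi fun _ : ι => μ) := by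
  obtain ⟨e, c, hc, hQe⟩ := exists_linearEquiv_eq_sum_sq Q hQ
  have hΦ' : (Φ ∘ e.symm) ∈ SchwartzBruhat (ι → F) := comp_linearEquiv_mem_schwartzBruhat hΦ e.symm
  obtain ⟨D, hDc, ⟨M, hM⟩, hD⟩ := exists_continuous_fibreDensity μ hd h2 hc hΦ' hr (ψ := ψ)
  set a : ℝ := ((normAbs F (LinearMap.det (e : (ι → F) →ₗ[F] (ι → F)))⁻¹ : ℝ≥0) : ℝ) with hadef
  have ha0 : 0 ≤ a := NNReal.coe_nonneg _
  refine ⟨fun b => (a : ℂ) * D b, continuous_const.mul hDc, ⟨a * M, fun b => ?_⟩, fun g hg => ?_⟩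
  · rw [norm_mul, Complex.norm_real, Real.norm_of_nonneg ha0]
    exact mul_le_mul_of_nonneg_left (hM b) ha0
  · rw [integral_mul_comp_eq_of_eq_sum_sq μ Φ g e c hQe, Complex.real_smul]
    simp_rw [mul_assoc]
    rw [integral_const_mul, hD g hg]
    rfl

/-- the same for the Gram-matrix form `x ↦ xᵀ S x` (`S` symmetric, `det S ≠ 0`). [cite: Weil1965, Chap. III n° 36 Prop. 6, p. 54] -/
theorem exists_continuous_fibreDensity_dotProduct_mulVec [Invertible (2 : F)] {d : ℤ} (hd : ψ.HasConductorExp d)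
    {v₂ : ℤ} (h2 : normAbs F (2 : F) = (residueFieldCard F : ℝ≥0)⁻¹ ^ v₂) {S : Matrix ι ι F} (hS : S.IsSymm)
    (hSd : S.det ≠ 0) {Φ : (ι → F) → ℂ} (hΦ : Φ ∈ SchwartzBruhat (ι → F)) (hr : 3 ≤ Fintype.card ι) :
    ∃ D : F → ℂ, Continuous D ∧ (∃ M : ℝ, ∀ b, ‖D b‖ ≤ M) ∧
      ∀ g ∈ SchwartzBruhat F, ∫ b, D b * g b ∂μ = ∫ x, Φ x * g (x ⬝ᵥ S *ᵥ x) ∂(Measure.pi fun _ : ι => μ) := by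
  obtain ⟨D, hDc, hDb, hD⟩ := exists_continuous_fibreDensity_quadraticForm μ hd h2 (Matrix.toQuadraticForm' S)
    (separatingLeft_associated_toQuadraticForm' hS hSd) hΦ hr (ψ := ψ)
  refine ⟨D, hDc, hDb, fun g hg => ?_⟩
  simpa only [toQuadraticForm'_apply] using hD g hg

end MatrixForm

end Literature.NumberTheory.Weil1965
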